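import Literature.Analysis.SingularIntegrals.HardyLittlewoodSobolevWeakMembership
import Literature.Analysis.FluidPDE.BiotSavartIntegral
import HarnessLib

/-!
# The Biot–Savart law on weak Lebesgue spaces: `K₃ ∗ : L^{p,∞}(ℝ³) → L^{q,∞}(ℝ³)`, `1/q = 1/p − 1/3`
# (endpoint case `p = 9/5 ↦ q = 9/2`)

Analysis/FluidPDE proof file (theorems only; no definition, no named fact). The tree's Biot–Savart
velocity `biotSavart ω x = ∫ K₃(x − y) ω(y) dy` (`Vorticity.lean`; Majda–Bertozzi (2.10)–(2.12)) is
dominated pointwise by the Riesz potential of order one of `‖ω‖`,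
`‖(K₃ ∗ ω)(x)‖ ≤ (4π)⁻¹ I₁‖ω‖(x)` (`|K₃(z)| ≤ (4π)⁻¹|z|⁻²`, `norm_biotSavartKernel_le`), for EVERY
`ω` and `x` (the Bochner integral is `0` where the integrand is not integrable, and
`‖∫f‖ ≤ ∫⁻‖f‖` always). Combined with the weak-type Hardy–Littlewood–Sobolev inequality of the tree
(`Literature.Analysis.SingularIntegrals.exists_weakHLS_one_R3`, `HardyLittlewoodSobolevWeak*.lean`;
Stein 1970 Ch. V §1.2–§1.4) this gives, for `1 < p < 3` and `q = 3p/(3 − p)`: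

* `meas_lt_norm_biotSavart_le` — `|{x : t < ‖(K₃ ∗ ω)(x)‖}| ≤ C (sup_s s^p|{‖ω‖ > s}|)^{3/(3−p)} t^{−q}`;
* `eWeakLpPow_biotSavart_le`, `memWeakLp_biotSavart` — `‖K₃ ∗ ω‖_{L^{q,∞}} ≲ ‖ω‖_{L^{p,∞}}`,
  `K₃ ∗ : L^{p,∞} → L^{q,∞}` in the tree's `eWeakLpPow` / `MemWeakLp` vocabulary
  (with `aestronglyMeasurable_biotSavart`, `biotSavart_congr_ae`);
* `memWeakLp_biotSavart_nineHalves` — the endpoint instance `ω ∈ L^{9/5,∞} ⟹ K₃ ∗ ω ∈ L^{9/2,∞}`,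
  the Lorentz–Hardy–Littlewood–Sobolev step of critical steady Navier–Stokes Liouville theorems with
  `curl v ∈ L^{9/5,∞}(ℝ³)` (e.g. the first half of Lemma 2.1 (2.3)/(2.8) of the C177 row
  `Literature.Claims.NS.Wu2026`, whose second half is the tree's
  `…Theorems.Wu2026Salvage.step_L21_of_weakHLS`; what this file does NOT supply is the representation
  `v = K₃ ∗ curl v` for non-integrable vorticity).

## Mathlib / tree search

`lean search 'biotSavart.*[Ww]eak|MemWeakLp.*biotSavart'`: nothing before this file. Used: tree
`norm_biotSavartKernel_le` (`BiotSavartBounds`), `measurable_biotSavartKernel` (`BiotSavartIntegral`),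
`exists_weakHLS_one_R3` (p568053), `eWeakLpPow_le_iff`, `eWeakLpPow_congr_ae`; Mathlib
`enorm_integral_le_lintegral_enorm`, `StronglyMeasurable.integral_prod_right`.

## References

* A. J. Majda, A. L. Bertozzi, *Vorticity and Incompressible Flow* (CUP 2002), §2.4.1 (2.10)–(2.12),
  (4.30) (the kernel bound). [MajdaBertozziCUP2002]
* E. M. Stein, *Singular integrals and differentiability properties of functions* (1970), Ch. V
  §1.2 Theorem 1, §1.4. [Stein1971]
-/

noncomputable section

open MeasureTheory Set Filter Topology Function
open scoped ENNReal NNReal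

namespace Literature.Analysis.FluidPDE

open Literature.Analysis.SingularIntegrals Literature.Analysis.FunctionSpaces

/-! ### Pointwise domination by the Riesz potential of order one -/

/-- `(r²)⁻¹ = r^{1−3}` for `r ≥ 0` (real powers; both sides `0` at `r = 0`). [folklore] -/
private theorem inv_sq_eq_rpow {r : ℝ} (hr : 0 ≤ r) : (r ^ 2)⁻¹ = r ^ ((1 : ℝ) - 3) := by
  rw [show (1 : ℝ) - 3 = -2 by norm_num, Real.rpow_neg hr, Real.rpow_two]

/-- **`‖(K₃ ∗ ω)(x)‖ ≤ (4π)⁻¹ I₁‖ω‖(x)`** for every vorticity `ω` and every point `x` (in `[0,∞]`;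
`I₁Φ(x) = ∫ Φ(y)‖x−y‖^{1−3} dy` is the tree's `rieszPotential volume 1`). Unconditional: where the
Biot–Savart integrand is not integrable the left side is `0`. [cite: MajdaBertozziCUP2002, §2.4.1 (2.10)–(2.12) with (4.30)] -/
theorem enorm_biotSavart_le_rieszPotential (ω : EuclideanSpace ℝ (Fin 3) → EuclideanSpace ℝ (Fin 3))
    (x : EuclideanSpace ℝ (Fin 3)) :
    ‖biotSavart ω x‖ₑ ≤ ENNReal.ofReal (4 * Real.pi)⁻¹ *
      rieszPotential volume 1 (fun y => (‖ω y‖ₑ : ℝ≥0∞)) x := by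
  have h3 : (Module.finrank ℝ (EuclideanSpace ℝ (Fin 3)) : ℝ) = 3 := by
    rw [finrank_euclideanSpace_fin]; norm_num
  rw [rieszPotential_def, h3]
  have hpt : ∀ y, (‖biotSavartKernel (x - y) (ω y)‖ₑ : ℝ≥0∞) ≤
      ENNReal.ofReal (4 * Real.pi)⁻¹ * (‖ω y‖ₑ * ENNReal.ofReal (‖x - y‖ ^ ((1 : ℝ) - 3))) := by
    intro y
    rw [← ofReal_norm, ← ofReal_norm, ← inv_sq_eq_rpow (norm_nonneg _),
      ← ENNReal.ofReal_mul (norm_nonneg _), ← ENNReal.ofReal_mul (by positivity)]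
    refine ENNReal.ofReal_le_ofReal ?_
    have := norm_biotSavartKernel_le (x - y) (ω y)
    linarith
  calc (‖biotSavart ω x‖ₑ : ℝ≥0∞)
      ≤ ∫⁻ y, ‖biotSavartKernel (x - y) (ω y)‖ₑ := enorm_integral_le_lintegral_enorm _
    _ ≤ ∫⁻ y, ENNReal.ofReal (4 * Real.pi)⁻¹ * (‖ω y‖ₑ * ENNReal.ofReal (‖x - y‖ ^ ((1 : ℝ) - 3))) :=
        lintegral_mono hpt
    _ = ENNReal.ofReal (4 * Real.pi)⁻¹ * ∫⁻ y, ‖ω y‖ₑ * ENNReal.ofReal (‖x - y‖ ^ ((1 : ℝ) - 3)) :=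
        lintegral_const_mul' _ _ ENNReal.ofReal_ne_top

/-- The superlevel sets of `‖K₃ ∗ ω‖` sit inside those of `I₁‖ω‖` at the level `4πt` (`t > 0`):
`{t < ‖(K₃ ∗ ω)(x)‖} ⊆ {4πt < I₁‖ω‖(x)}`. [cite: MajdaBertozziCUP2002, §2.4.1 (4.30)] -/
theorem setOf_lt_norm_biotSavart_subset (ω : EuclideanSpace ℝ (Fin 3) → EuclideanSpace ℝ (Fin 3))
    {t : ℝ} (ht : 0 < t) :
    {x | t < ‖biotSavart ω x‖} ⊆
      {x | ENNReal.ofReal (4 * Real.pi * t) < rieszPotential volume 1 (fun y => (‖ω y‖ₑ : ℝ≥0∞)) x} := by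
  intro x hx
  rw [mem_setOf_eq] at hx ⊢
  have hπ : 0 < 4 * Real.pi := by positivity
  have h1 : ENNReal.ofReal t < ‖biotSavart ω x‖ₑ := by
    rw [← ofReal_norm]
    exact (ENNReal.ofReal_lt_ofReal_iff (ht.trans hx)).2 hx
  have h2 := h1.trans_le (enorm_biotSavart_le_rieszPotential ω x)
  by_contra hle
  rw [not_lt] at hle
  have h4 : ENNReal.ofReal (4 * Real.pi)⁻¹ * rieszPotential volume 1 (fun y => (‖ω y‖ₑ : ℝ≥0∞)) x ≤
      ENNReal.ofReal t := by
    calc ENNReal.ofReal (4 * Real.pi)⁻¹ * rieszPotential volume 1 (fun y => (‖ω y‖ₑ : ℝ≥0∞)) x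
        ≤ ENNReal.ofReal (4 * Real.pi)⁻¹ * ENNReal.ofReal (4 * Real.pi * t) := mul_le_mul_right hle _
      _ = ENNReal.ofReal t := by
          rw [← ENNReal.ofReal_mul (by positivity), ← mul_assoc, inv_mul_cancel₀ hπ.ne', one_mul]
  exact absurd (h2.trans_le h4) (lt_irrefl _)

/-! ### The weak-type bound for the Biot–Savart law -/

/-- **`K₃ ∗` is of weak type `(L^{p,∞}, L^{q,∞})`, distribution-function form**: for `1 < p < 3`,
`q = 3p/(3−p)`, there is `C < ∞` with
`|{x : t < ‖(K₃ ∗ ω)(x)‖}| ≤ C (sup_s s^p |{‖ω‖ > s}|)^{3/(3−p)} t^{−q}` for every a.e.-strongly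
measurable `ω` and `t > 0` (pointwise domination by `I₁‖ω‖` + weak HLS at level `4πt`).
[cite: Stein1971, Ch. V §1.2 Theorem 1 and §1.4 (Comment)] -/
theorem meas_lt_norm_biotSavart_le {p : ℝ≥0∞} (hp : 1 < p.toReal) (hp3 : p.toReal < 3) :
    ∃ C : ℝ≥0∞, C < ∞ ∧ ∀ ω : EuclideanSpace ℝ (Fin 3) → EuclideanSpace ℝ (Fin 3),
      AEStronglyMeasurable ω volume → ∀ t : ℝ, 0 < t →
        volume {x | t < ‖biotSavart ω x‖} ≤
          C * eWeakLpPow ω p volume ^ (3 / (3 - p.toReal)) *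
            ENNReal.ofReal (t ^ (-(3 * p.toReal / (3 - p.toReal)))) := by
  obtain ⟨C, hC, H⟩ := exists_weakHLS_one_R3 (F := EuclideanSpace ℝ (Fin 3)) hp hp3
  set q : ℝ := 3 * p.toReal / (3 - p.toReal) with hq
  have hπ : 0 < 4 * Real.pi := by positivity
  refine ⟨C * ENNReal.ofReal ((4 * Real.pi) ^ (-q)), ENNReal.mul_lt_top hC ENNReal.ofReal_lt_top,
    fun ω hω t ht => ?_⟩
  have h := H ω hω (4 * Real.pi * t) (mul_pos hπ ht)
  calc volume {x | t < ‖biotSavart ω x‖}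
      ≤ volume {x | ENNReal.ofReal (4 * Real.pi * t) <
          rieszPotential volume 1 (fun y => (‖ω y‖ₑ : ℝ≥0∞)) x} :=
        measure_mono (setOf_lt_norm_biotSavart_subset ω ht)
    _ ≤ C * eWeakLpPow ω p volume ^ (3 / (3 - p.toReal)) *
          ENNReal.ofReal ((4 * Real.pi * t) ^ (-q)) := h
    _ = C * ENNReal.ofReal ((4 * Real.pi) ^ (-q)) * eWeakLpPow ω p volume ^ (3 / (3 - p.toReal)) *
          ENNReal.ofReal (t ^ (-q)) := by
        rw [Real.mul_rpow hπ.le ht.le, ENNReal.ofReal_mul (Real.rpow_nonneg hπ.le _)]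
        ring

/-! ### Measurability and weak-`L^q` membership -/

/-- The Biot–Savart velocity only depends on the a.e. class of the vorticity (it is a Lebesgue
integral in `y`). [cite: MajdaBertozziCUP2002, §2.4.1 (2.10)–(2.12)] -/
theorem biotSavart_congr_ae {ω ω' : EuclideanSpace ℝ (Fin 3) → EuclideanSpace ℝ (Fin 3)}
    (h : ω =ᵐ[volume] ω') : biotSavart ω = biotSavart ω' := by
  funext x
  exact integral_congr_ae (h.mono fun y hy => by simp only [hy])

/-- The Biot–Savart velocity of a measurable vorticity is strongly measurable (joint measurability
of `(x, y) ↦ K₃(x − y) ω(y)` and Fubini measurability of parametric Bochner integrals).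
[cite: MajdaBertozziCUP2002, §2.4.1 (2.10)–(2.12)] -/
theorem stronglyMeasurable_biotSavart {ω : EuclideanSpace ℝ (Fin 3) → EuclideanSpace ℝ (Fin 3)}
    (hω : Measurable ω) : StronglyMeasurable (biotSavart ω) := by
  unfold biotSavart
  apply StronglyMeasurable.integral_prod_right
    (f := fun x y : EuclideanSpace ℝ (Fin 3) => biotSavartKernel (x - y) (ω y))
  exact (measurable_biotSavartKernel.comp
    ((measurable_fst.sub measurable_snd).prodMk (hω.comp measurable_snd))).stronglyMeasurable

/-- The Biot–Savart velocity of an a.e.-strongly measurable vorticity is a.e.-strongly measurable.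
[cite: MajdaBertozziCUP2002, §2.4.1 (2.10)–(2.12)] -/
theorem aestronglyMeasurable_biotSavart {ω : EuclideanSpace ℝ (Fin 3) → EuclideanSpace ℝ (Fin 3)}
    (hω : AEStronglyMeasurable ω volume) : AEStronglyMeasurable (biotSavart ω) volume := by
  rw [biotSavart_congr_ae hω.ae_eq_mk]
  exact (stronglyMeasurable_biotSavart hω.stronglyMeasurable_mk.measurable).aestronglyMeasurable

/-- **`‖K₃ ∗ ω‖_{L^{q,∞}} ≲ ‖ω‖_{L^{p,∞}}`** in the tree's weak-`L^p` vocabulary: for `1 < p < 3`,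
`q = 3p/(3−p)`, there is `C < ∞` with
`sup_t t^q |{t < ‖K₃ ∗ ω‖}| ≤ C (sup_s s^p |{‖ω‖ > s}|)^{3/(3−p)}` for every a.e.-strongly measurable
`ω`. [cite: Stein1971, Ch. V §1.2 Theorem 1 and §1.4 (Comment)] -/
theorem eWeakLpPow_biotSavart_le {p : ℝ≥0∞} (hp : 1 < p.toReal) (hp3 : p.toReal < 3) :
    ∃ C : ℝ≥0∞, C < ∞ ∧ ∀ ω : EuclideanSpace ℝ (Fin 3) → EuclideanSpace ℝ (Fin 3),
      AEStronglyMeasurable ω volume →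
        eWeakLpPow (biotSavart ω) (ENNReal.ofReal (3 * p.toReal / (3 - p.toReal))) volume ≤
          C * eWeakLpPow ω p volume ^ (3 / (3 - p.toReal)) := by
  obtain ⟨C, hC, H⟩ := meas_lt_norm_biotSavart_le hp hp3
  set q : ℝ := 3 * p.toReal / (3 - p.toReal) with hq
  have hq0 : 0 < q := div_pos (by linarith) (by linarith)
  refine ⟨C, hC, fun ω hω => ?_⟩
  set W : ℝ≥0∞ := eWeakLpPow ω p volume with hW
  rw [eWeakLpPow_le_iff]
  intro t
  have hqq : (ENNReal.ofReal q).toReal = q := ENNReal.toReal_ofReal hq0.le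
  rw [hqq]
  rcases eq_or_ne t 0 with ht0 | ht0
  · rw [ht0, ENNReal.coe_zero, ENNReal.zero_rpow_of_pos hq0, zero_mul]; exact bot_le
  have htpos : (0 : ℝ) < t := NNReal.coe_pos.2 (pos_iff_ne_zero.2 ht0)
  have hset : {x | (t : ℝ≥0∞) < ‖biotSavart ω x‖ₑ} ⊆ {x | (t : ℝ) < ‖biotSavart ω x‖} := by
    intro x hx
    rw [mem_setOf_eq] at hx ⊢
    rw [← ENNReal.ofReal_coe_nnreal, ← ofReal_norm] at hx
    exact (ENNReal.ofReal_lt_ofReal_iff'.1 hx).1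
  have hone : (t : ℝ≥0∞) ^ q * ENNReal.ofReal ((t : ℝ) ^ (-q)) = 1 := by
    rw [← ENNReal.ofReal_coe_nnreal, ENNReal.ofReal_rpow_of_pos htpos,
      ← ENNReal.ofReal_mul (by positivity), ← Real.rpow_add htpos, add_neg_cancel, Real.rpow_zero,
      ENNReal.ofReal_one]
  calc (t : ℝ≥0∞) ^ q * volume {x | (t : ℝ≥0∞) < ‖biotSavart ω x‖ₑ}
      ≤ (t : ℝ≥0∞) ^ q * volume {x | (t : ℝ) < ‖biotSavart ω x‖} :=
        mul_le_mul_right (measure_mono hset) _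
    _ ≤ (t : ℝ≥0∞) ^ q * (C * W ^ (3 / (3 - p.toReal)) * ENNReal.ofReal ((t : ℝ) ^ (-q))) :=
        mul_le_mul_right (H ω hω t htpos) _
    _ = C * W ^ (3 / (3 - p.toReal)) * ((t : ℝ≥0∞) ^ q * ENNReal.ofReal ((t : ℝ) ^ (-q))) := by ring
    _ = C * W ^ (3 / (3 - p.toReal)) := by rw [hone, mul_one]

/-- **The Biot–Savart law maps `L^{p,∞}(ℝ³)` into `L^{q,∞}(ℝ³)`**, `1 < p < 3`, `1/q = 1/p − 1/3`.
[cite: Stein1971, Ch. V §1.2 Theorem 1 and §1.4 (Comment)] -/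
theorem memWeakLp_biotSavart {p : ℝ≥0∞} (hp : 1 < p.toReal) (hp3 : p.toReal < 3)
    {ω : EuclideanSpace ℝ (Fin 3) → EuclideanSpace ℝ (Fin 3)} (hω : MemWeakLp ω p volume) :
    MemWeakLp (biotSavart ω) (ENNReal.ofReal (3 * p.toReal / (3 - p.toReal))) volume := by
  obtain ⟨C, hC, H⟩ := eWeakLpPow_biotSavart_le hp hp3
  have ha0 : 0 ≤ 3 / (3 - p.toReal) := (div_pos (by norm_num) (by linarith)).le
  exact ⟨aestronglyMeasurable_biotSavart hω.1, lt_of_le_of_lt (H ω hω.1)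
    (ENNReal.mul_lt_top hC (ENNReal.rpow_lt_top_of_nonneg ha0 hω.2.ne))⟩

/-- **The endpoint instance `ω ∈ L^{9/5,∞}(ℝ³) ⟹ K₃ ∗ ω ∈ L^{9/2,∞}(ℝ³)`** — the Lorentz–HLS step of
the critical steady Navier–Stokes Liouville theorems with `curl v ∈ L^{9/5,∞}`.
[cite: Stein1971, Ch. V §1.2 Theorem 1 and §1.4 (Comment)] -/
theorem memWeakLp_biotSavart_nineHalves {ω : EuclideanSpace ℝ (Fin 3) → EuclideanSpace ℝ (Fin 3)}
    (hω : MemWeakLp ω ((9 : ℝ≥0∞) / 5) volume) :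
    MemWeakLp (biotSavart ω) ((9 : ℝ≥0∞) / 2) volume := by
  have h95 : ((9 : ℝ≥0∞) / 5).toReal = 9 / 5 := by rw [ENNReal.toReal_div]; norm_num
  have h92 : ((9 : ℝ≥0∞) / 2).toReal = 9 / 2 := by rw [ENNReal.toReal_div]; norm_num
  have h := memWeakLp_biotSavart (p := (9 : ℝ≥0∞) / 5) (by rw [h95]; norm_num) (by rw [h95]; norm_num) hω
  have e : ENNReal.ofReal (3 * ((9 : ℝ≥0∞) / 5).toReal / (3 - ((9 : ℝ≥0∞) / 5).toReal)) =
      (9 : ℝ≥0∞) / 2 := by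
    rw [h95, show (3 : ℝ) * (9 / 5) / (3 - 9 / 5) = 9 / 2 by norm_num,
      ENNReal.ofReal_div_of_pos two_pos]
    norm_num
  rwa [e] at h

end Literature.Analysis.FluidPDE

end

-- WHAT THIS IS NOT: not a claim about NS regularity or blow-up; not a claim about any author beyond the typed locator.
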